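import Mathlib
import HarnessLib

/-!
# Separating the complex embeddings of a number field, and finitely many weights, by one integral element

Elementary number theory of a number field `F` (no CM hypothesis) of the kind used when a family of
commuting operators indexed by algebraic integers has to be replaced by ONE operator with the same
eigenspace decomposition:

* **`exists_ringOfIntegers_separating_embeddings`** — there is an algebraic integer `β ∈ 𝓞 F` such that
  `s ↦ s(β)` is injective on `Hom(F, ℂ)` (an integral multiple of a primitive element: Mathlib's
  `Field.exists_primitive_element`, `Field.primitive_element_iff_algHom_eq_of_eval'`,
  `exists_integral_multiples`);
* **`finset_eq_of_forall_prod_add_eq`** — if such a `β` satisfies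
  `∏_{s ∈ S} (t + s β) = ∏_{s ∈ S'} (t + s β)` for every `t ∈ ℕ` then `S = S'` (two monic polynomials that agree
  at infinitely many points have the same multiset of roots: `Polynomial.eq_of_infinite_eval_eq`,
  `Polynomial.roots_multiset_prod_X_sub_C`);
* **`exists_ringOfIntegers_prod_embeddings_ne`** — hence two distinct finite sets `S ≠ S'` of embeddings have
  distinct product characters `a ↦ ∏_{s ∈ S} s(a)` on `𝓞 F` (some `a = t + β` separates them);
* **`exists_nat_functional_injective`** — finitely many points of `ℂ^ι` are separated by ONE linear functional
  with natural-number coefficients `c_i = t ^ e(i)` (choose `t ∈ ℕ` outside the finitely many natural roots of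
  the pairwise difference polynomials along the moment curve);
* **`exists_separating_weight_functional`** — consequently, for "weights" `S = (S_j)_{j ≤ n}`,
  `S_j ⊆ Hom(F, ℂ)` finite, there are finitely many pairs `(j_i, a_i)` with `a_i ∈ 𝓞 F` and coefficients
  `c_i ∈ ℕ` such that `S ↦ Σ_i c_i ∏_{s ∈ S_{j_i}} s(a_i)` is injective (index set: ordered pairs of weights).

All statements are standard ("folklore"); the proofs are short exercises on the primitive element theorem and
on polynomial identity testing, recorded here because Mathlib has the ingredients but not the packaged
statements.

## References

* Primitive element theorem and its embedding form: Mathlib `Mathlib.FieldTheory.PrimitiveElement`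
  (`Field.exists_primitive_element`, `Field.primitive_element_iff_algHom_eq_of_eval'`).
* D. A. Marcus, *Number Fields*, Ch. 2 (embeddings of a number field are determined by the image of a
  primitive element) — background only; nothing here is cited as a fact.

## Provenance

Staged by the pub-hodgecm formalisation cell (EXPANSION part (b) `PohlmannSpan` lineage, generation 15) under
the LEAN-IN-TREE rule: it supersedes FOR THE TREE the cell's standalone package file
`HodgeCM/Proofs/Pohlmann/Separation.lean` (generation 1; same five theorems and proofs, namespace
`HodgeCM.Pohlmann` ↦ `Literature.NumberTheory.NumberFields`; names `exists_ringOfIntegers_separating` ↦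
`exists_ringOfIntegers_separating_embeddings`, `exists_prod_ne` ↦ `exists_ringOfIntegers_prod_embeddings_ne`,
`exists_separating_family` ↦ `exists_separating_weight_functional`, the other two unchanged). The package
copy stays for the package build until the summit-side migration re-points its one importer
(`HodgeCM/Proofs/PohlmannSpan.lean`).

## Not here

Anything about CM fields, CM types, Hodge structures or abelian varieties; the operators whose eigenvalues
these characters are (summit-side).
-/

set_option autoImplicit false

noncomputable section

namespace Literature.NumberTheory.NumberFields

open _root_.Polynomial
open scoped _root_.NumberField

/-! ### An algebraic integer separating the complex embeddings -/

section Embeddings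

variable {F : Type*} [Field F] [NumberField F]

/-- A number field `F` has an algebraic integer `β ∈ 𝓞 F` with `s ↦ s(β)` injective on `Hom(F, ℂ)`: take a
primitive element `α` of `F/ℚ` (its image determines an embedding) and clear denominators, `β = d • α` with
`d ∈ ℤ ∖ {0}`. [folklore] -/
theorem exists_ringOfIntegers_separating_embeddings :
    ∃ β : 𝓞 F, Function.Injective fun s : F →+* ℂ => s (β : F) := by
  obtain ⟨α, hα⟩ := Field.exists_primitive_element ℚ F
  have hinj : Function.Injective fun φ : F →ₐ[ℚ] ℂ => φ α :=
    (Field.primitive_element_iff_algHom_eq_of_eval' ℚ ℂ (fun x => IsAlgClosed.splits _) α).1 hα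
  obtain ⟨d, hd, hdα⟩ := exists_integral_multiples ℤ ℚ ({α} : Finset F)
  have hint : IsIntegral ℤ ((d : F) * α) := by
    have h := hdα α (Finset.mem_singleton_self α)
    rwa [Algebra.smul_def, algebraMap_int_eq, eq_intCast] at h
  refine ⟨⟨(d : F) * α, (mem_integralClosure_iff ℤ F).2 hint⟩, fun s s' hss' => ?_⟩
  have h1 : (d : ℂ) * s α = (d : ℂ) * s' α := by
    simpa [NumberField.RingOfIntegers.map_mk, map_mul, map_intCast] using hss'
  have h2 : s α = s' α := mul_left_cancel₀ (Int.cast_ne_zero.2 hd) h1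
  have h3 : s.toRatAlgHom = s'.toRatAlgHom := hinj (by simpa using h2)
  simpa using congrArg AlgHom.toRingHom h3

omit [NumberField F] in
/-- If `β` separates the embeddings of `F` and `∏_{s ∈ S} (t + s β) = ∏_{s ∈ S'} (t + s β)` for all `t ∈ ℕ`,
then `S = S'`: the monic polynomials `∏_{s ∈ S} (X + s β)` and `∏_{s ∈ S'} (X + s β)` agree at infinitely many
points, hence are equal, hence have the same multiset of roots `{-s β}`, and `s ↦ -s β` is injective.
[folklore] -/
theorem finset_eq_of_forall_prod_add_eq {β : F} (hβ : Function.Injective fun s : F →+* ℂ => s β)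
    {S S' : Finset (F →+* ℂ)}
    (h : ∀ t : ℕ, ∏ s ∈ S, ((t : ℂ) + s β) = ∏ s ∈ S', ((t : ℂ) + s β)) : S = S' := by
  classical
  let P : Finset (F →+* ℂ) → ℂ[X] := fun S => ∏ s ∈ S, (X + C (s β))
  have hPeval : ∀ (S : Finset (F →+* ℂ)) (t : ℕ),
      (P S).eval (t : ℂ) = ∏ s ∈ S, ((t : ℂ) + s β) := by
    intro S t
    simp [P, eval_prod]
  have hPP : P S = P S' := by
    apply Polynomial.eq_of_infinite_eval_eq
    refine Set.Infinite.mono ?_ (Set.infinite_range_of_injective (Nat.cast_injective (R := ℂ)))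
    rintro _ ⟨t, rfl⟩
    simp only [Set.mem_setOf_eq, hPeval, h t]
  have hroots : ∀ S : Finset (F →+* ℂ), (P S).roots = S.val.map fun s => -(s β) := by
    intro S
    have hS : P S = ((S.val.map fun s => -(s β)).map fun a => X - C a).prod := by
      simp only [P, Finset.prod_eq_multiset_prod, Multiset.map_map, Function.comp_def, map_neg,
        sub_neg_eq_add]
    rw [hS, roots_multiset_prod_X_sub_C]
  have hinj : Function.Injective fun s : F →+* ℂ => -(s β) := neg_injective.comp hβ
  have hr := congrArg Polynomial.roots hPP
  rw [hroots, hroots] at hr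
  exact Finset.val_inj.1 (Multiset.map_injective hinj hr)

/-- **Distinct finite sets of embeddings have distinct product characters on `𝓞 F`**: if `S ≠ S'` are finite
sets of embeddings `F → ℂ`, some algebraic integer `a ∈ 𝓞 F` has `∏_{s ∈ S} s(a) ≠ ∏_{s ∈ S'} s(a)` (namely
`a = t + β` for a separating `β` and a suitable `t ∈ ℕ`). [folklore] -/
theorem exists_ringOfIntegers_prod_embeddings_ne {S S' : Finset (F →+* ℂ)} (hne : S ≠ S') :
    ∃ a : 𝓞 F, ∏ s ∈ S, s (a : F) ≠ ∏ s ∈ S', s (a : F) := by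
  obtain ⟨β, hβ⟩ := exists_ringOfIntegers_separating_embeddings (F := F)
  by_contra h
  simp only [not_exists, not_not] at h
  apply hne
  refine finset_eq_of_forall_prod_add_eq hβ fun t => ?_
  have ht := h (t + β)
  simpa [map_add, map_natCast] using ht

end Embeddings

/-! ### A functional with natural-number coefficients separating finitely many complex points -/

section Generic

variable {𝒮 ι : Type*} [Finite 𝒮] [Fintype ι]

/-- **Finitely many points of `ℂ^ι` are separated by one functional with coefficients in `ℕ`**: for an
injective `E : 𝒮 → (ι → ℂ)` with `𝒮` finite there is `c : ι → ℕ` with `S ↦ Σ_i c_i · E S i` injective. Proof: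
along the moment curve `c_i = t ^ e(i)` (`e : ι ≃ Fin |ι|`) the difference of the values at two points `S ≠ S'`
is a nonzero polynomial in `t`, so all `t ∈ ℕ` outside finitely many roots work. [folklore] -/
theorem exists_nat_functional_injective (E : 𝒮 → ι → ℂ) (hE : Function.Injective E) :
    ∃ c : ι → ℕ, Function.Injective fun S => ∑ i, (c i : ℂ) * E S i := by
  classical
  haveI := Fintype.ofFinite 𝒮
  let e := Fintype.equivFin ι
  -- the difference polynomial of a pair along the moment curve `c_i = t^{e i}`
  let p : 𝒮 → 𝒮 → ℂ[X] := fun S S' => ∑ i, monomial (e i) (E S i - E S' i)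
  have hp_eval : ∀ (S S' : 𝒮) (t : ℕ), (p S S').eval (t : ℂ) =
      ∑ i, ((t ^ (e i : ℕ) : ℕ) : ℂ) * E S i - ∑ i, ((t ^ (e i : ℕ) : ℕ) : ℂ) * E S' i := by
    intro S S' t
    simp only [p, eval_finsetSum, eval_monomial, Nat.cast_pow, ← Finset.sum_sub_distrib]
    exact Finset.sum_congr rfl fun i _ => by ring
  have hp_ne : ∀ S S' : 𝒮, S ≠ S' → p S S' ≠ 0 := by
    intro S S' hSS' h0
    apply hSS'
    apply hE
    funext i
    have hc := congrArg (fun q : ℂ[X] => q.coeff (e i)) h0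
    simp only [p, finsetSum_coeff, coeff_monomial, coeff_zero] at hc
    rw [Finset.sum_eq_single i (fun i' _ hi' => if_neg fun h => hi' (e.injective (Fin.ext h)))
      (fun hi => absurd (Finset.mem_univ i) hi), if_pos rfl] at hc
    exact sub_eq_zero.1 hc
  -- finitely many bad parameters `t`
  let bad : Finset ℕ := Finset.univ.biUnion fun SS : 𝒮 × 𝒮 =>
    ((p SS.1 SS.2).roots.toFinset).preimage Nat.cast Nat.cast_injective.injOn
  obtain ⟨t, ht⟩ := Infinite.exists_notMem_finset bad
  refine ⟨fun i => t ^ (e i : ℕ), fun S S' hSS' => ?_⟩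
  by_contra hne
  apply ht
  simp only [bad, Finset.mem_biUnion, Finset.mem_univ, true_and, Finset.mem_preimage,
    Multiset.mem_toFinset, Prod.exists]
  refine ⟨S, S', ?_⟩
  rw [mem_roots (hp_ne S S' hne), IsRoot.def, hp_eval, sub_eq_zero]
  exact hSS'

end Generic

/-! ### One natural-number combination of product characters separating all weights -/

section Family

variable {F : Type*} [Field F] [NumberField F]

/-- **Separation of weights by one functional.** For weights `S = (S_j)_{j ≤ n}` with each `S_j` a finite set
of embeddings `F → ℂ`, there are finitely many pairs `(j_i, a_i)` (`a_i ∈ 𝓞 F`) and coefficients `c_i ∈ ℕ`,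
indexed by the ordered pairs of weights, such that `S ↦ Σ_i c_i ∏_{s ∈ S_{j_i}} s(a_i)` is injective: each
pair of distinct weights differs in some coordinate `j`, where `exists_ringOfIntegers_prod_embeddings_ne`
separates them, and `exists_nat_functional_injective` combines the separating characters. [folklore] -/
theorem exists_separating_weight_functional (n : ℕ) :
    ∃ (j : (Fin (n + 1) → Finset (F →+* ℂ)) × (Fin (n + 1) → Finset (F →+* ℂ)) → Fin (n + 1))
      (a : (Fin (n + 1) → Finset (F →+* ℂ)) × (Fin (n + 1) → Finset (F →+* ℂ)) → 𝓞 F)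
      (c : (Fin (n + 1) → Finset (F →+* ℂ)) × (Fin (n + 1) → Finset (F →+* ℂ)) → ℕ),
      Function.Injective fun S : Fin (n + 1) → Finset (F →+* ℂ) =>
        ∑ i, (c i : ℂ) * ∏ s ∈ S (j i), s (a i : F) := by
  classical
  -- for each ordered pair of distinct weights, a factor and an algebraic integer separating them
  have key : ∀ d : (Fin (n + 1) → Finset (F →+* ℂ)) × (Fin (n + 1) → Finset (F →+* ℂ)),
      ∃ (j : Fin (n + 1)) (a : 𝓞 F),
        d.1 ≠ d.2 → ∏ s ∈ d.1 j, s (a : F) ≠ ∏ s ∈ d.2 j, s (a : F) := by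
    rintro ⟨S, S'⟩
    by_cases h : S = S'
    · exact ⟨0, 0, fun h' => absurd h h'⟩
    · obtain ⟨j, hj⟩ := Function.ne_iff.1 h
      obtain ⟨a, ha⟩ := exists_ringOfIntegers_prod_embeddings_ne hj
      exact ⟨j, a, fun _ => ha⟩
  choose j a hja using key
  obtain ⟨c, hc⟩ := exists_nat_functional_injective
    (fun (S : Fin (n + 1) → Finset (F →+* ℂ)) d => ∏ s ∈ S (j d), s (a d : F)) (by
      intro S S' hSS'
      by_contra hne
      exact hja (S, S') hne (congrFun hSS' (S, S')))
  exact ⟨j, a, c, hc⟩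

end Family

end Literature.NumberTheory.NumberFields

end
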